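import Summits.ValiantsHypothesis.ValiantsHypothesis.Theorems.FifoMatchingNNDivisionHardExactPencilQPairDecided
import HarnessLib

/-!
# EXACT PENCILS IV — zero-diagonal difference cubes (`Z_mix` shape): the direction `W^z` and its exact rhs `h_COR(W^z) = F⋆` on the transversal face (crux `NNDivisionHard`, stmt-ValiantsHypothesis-21181) — `ExactPencil` port part 4/12

Theorems-side port (staged by val-idea-40 g6, C′-census owner per director-valiant R331 (2)(e) / desk #399, for the port hands;
press as `Theorems/FifoMatchingNNDivisionHardExactPencilZgenFace.lean`, `--kind proof --supports stmt-ValiantsHypothesis-21181 --as helper`; sig-first val-idea-crit-9 g3) of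
§9 (first part: through `hCOR_Wz`) of val-idea-38 g2's crux workfile `Cruxes/NNDivisionHard/ExactPencil38.lean` REV 16 @4e81d1716f6b (sha16 d9f2e288279a0b09, 3 456 l., FROZEN — final from 38 g2, bus 01:14:51Z; critic of record val-idea-crit-9 g2/g3: `CRITIC-wave6.md` FINAL + V#97 §2 «rev 14/15 δ KERNEL VERIFIED»).  Declaration texts VERBATIM (namespace
`…Theorems.FifoMatching.ExactPencil`; one-line docstrings added where the source had none); the 40-g5 tools the source RESTATED are
DROPPED here and cited BY NAME from the landed ports `…Theorems.FifoMatching.LocatedRows.*` (✓ p680125 … p683387: `T`, `RowFamily`,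
`hCOR`, `exactTilted`, `ExactPencilLaw`, `pinnedRows`, `unflat`, `three_pow_le_of_block`, `two_pow_half_mul_le`, `zgen`, `cubePt`, …) and
`…Theorems.FifoMatching.XcDivision` (`udRow`, `udPt`, `udInd`, `udMat`, …), so that C′ stays ONE Theorems declaration
`LocatedRows.ExactPencilLaw`.  Part 4/12 of the port (imports part 3, `…Theorems.FifoMatchingNNDivisionHardExactPencilQPairDecided`).

* `IsZgenCube` (generators `zgen k l m = E^s_{kl} − E^s_{km}`, landed `LocatedRows.zgen` / `cubePt`), `flat_dotProduct_zgen`, `udRow_dotProduct_zgen`,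
  `sIdx`, `μz`, `WzInt`, `Wz` (`W^z`), `Wz_sub_trichotomy`, `Wz_sub_ne_zero_of_lt`, `flat_dotProduct_udPt_sum`, `rep`, `mem_Bcol_iff_rep`, `sum_Bcol`,
  `Fstar`, `Wz_rep`, `Wz_dotProduct_Bcol`, ★ `Wz_dotProduct_udPt_le`, ★ `hCOR_Wz` (`h_COR(W^z) = F⋆`, attained exactly on the transversal face).

HONEST LABEL: every theorem here is a DECIDED SPECIES / support lemma for the OPEN law C′ = `LocatedRows.ExactPencilLaw`
(`exactTilted.Law`); the crux 21181 `NNDivisionHard`, C′, `allRows.Law` and COR-VIRTUAL are OPEN; C⁺_entry `LocatedPencilLaw` is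
REFUTED (✓ p679540).  VP ≠ VNP is NOT proved here or anywhere in this tree.
-/

set_option autoImplicit false

-- the mandated summit-side namespace repeats a component by design (single-problem summit)
set_option linter.dupNamespace false

noncomputable section

open Matrix Finset
open scoped Pointwise

namespace Summit.ValiantsHypothesis.ValiantsHypothesis.Theorems.FifoMatching.ExactPencil

open Literature.Barriers.PneNP (HasEFOfSize three_pow_le_card_mul_two_pow_of_cover_univ)
open Literature.Combinatorics.Optimization.FixedSizePsdRank
  (corPolytope flat vecOuter flat_dotProduct_le_of_mem_corPolytope flat_dotProduct_vecOuter)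
open Summit.ValiantsHypothesis.ValiantsHypothesis.Theorems.FifoMatching.XcDivision
  (udRow udPt udInd udMat ud_data udInd_apply udInd_sq dot_le_of_mem_convexHull flat_dotProduct_flat)
open Summit.ValiantsHypothesis.ValiantsHypothesis.Theorems.FifoMatching.LocatedRows
  (T CorVirtualHardN RowFamily corVirtualHardN_of_law flat_le_box entryTilted allRows LocatedPencilLaw
    hCOR le_hCOR exists_eq_hCOR flat_le_hCOR hCOR_le_box exactTilted ExactPencilLaw exactTilted_emb_allRows
    corVirtualHardN_of_exactPencilLaw three_pow_le_of_block two_pow_half_mul_le pinnedRows unflat flat_unflat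
    pinnedRows_emb_exactTilted corVirtualHardN_of_pinnedRowsLaw zgen cubePt dotProduct_cubePt)

/-! ## §9 (rev 6) BEYOND THE PIN CEILING — cubes of zero-diagonal differences `zgen k l m = E^s_{kl} − E^s_{km}` (the `Z_mix` shape; 40 g5's
all-triples cube is NOT `PinExposed`) are DECIDED by C′ at the TRANSVERSAL face `{B_S = ι₁(S) ∪ ι₂(Sᶜ)}` of `W^z` (`Wz`, exact rhs `hCOR_Wz`, even
integer pins `Wz_dotProduct_zgen` vs clique weights `∈ {0, ±2}`, common maximiser by the constant-sign rule `zsc_le_star`, block `UDISJ_k`):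
★ `exactTilted_law_holds_on_zgenCube`, ★ `cor_add_zgenCube_decided`.  The pin ceiling bounds `PinExposed`, not C′. -/

section ZgenCube
variable {n : ℕ}

/-- «every generator is a zero-diagonal difference `E^s_{kl} − E^s_{km}`» (the all-triples cube of 40 g5 §5b is one). -/
def IsZgenCube {N : ℕ} (G : Fin N → Matrix (Fin n) (Fin n) ℝ) : Prop :=
  ∀ t, ∃ k l m : Fin n, k ≠ l ∧ k ≠ m ∧ l ≠ m ∧ G t = zgen k l m

/-- `[A ∨ B] = [A] + [B]` for exclusive `A`, `B` (real-valued indicators). -/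
theorem ite_or_eq_add {A B : Prop} [Decidable A] [Decidable B] (h : ¬ (A ∧ B)) :
    (if A ∨ B then (1 : ℝ) else 0) = (if A then 1 else 0) + (if B then 1 else 0) := by
  by_cases hA : A <;> by_cases hB : B
  · exact absurd ⟨hA, hB⟩ h
  all_goals simp [hA, hB]

/-- the symmetrised-entry read of a difference generator (40 g5 `flat_dotProduct_flat_zgen`, reproved over `flat_dotProduct_flat`). -/
theorem flat_dotProduct_zgen (C : Matrix (Fin n) (Fin n) ℝ) {k l m : Fin n} (hkl : k ≠ l) (hkm : k ≠ m) :
    flat C ⬝ᵥ flat (zgen k l m) = (C k l + C l k) - (C k m + C m k) := by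
  rw [flat_dotProduct_flat]
  have h : ∀ i j : Fin n, C i j * zgen k l m i j =
      (C i j * (if i = k ∧ j = l then (1 : ℝ) else 0) + C i j * (if i = l ∧ j = k then (1 : ℝ) else 0)) -
      (C i j * (if i = k ∧ j = m then (1 : ℝ) else 0) + C i j * (if i = m ∧ j = k then (1 : ℝ) else 0)) := by
    intro i j
    unfold zgen
    rw [ite_or_eq_add (fun hh => hkl (hh.1.1.symm.trans hh.2.1)), ite_or_eq_add (fun hh => hkm (hh.1.1.symm.trans hh.2.1))]
    ring
  simp_rw [h]
  simp only [Finset.sum_sub_distrib, Finset.sum_add_distrib, sum_sum_mul_ite_and]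
  ring

/-- CLIQUE WEIGHT of a difference generator: `⟨2diag(𝟙_a) − 𝟙_a𝟙_aᵀ, E^s_{kl} − E^s_{km}⟩ = 2·𝟙[k∈a](𝟙[m∈a] − 𝟙[l∈a]) ∈ {0, ±2}`. -/
theorem udRow_dotProduct_zgen (a : Finset (Fin n)) {k l m : Fin n} (hkl : k ≠ l) (hkm : k ≠ m) :
    udRow a ⬝ᵥ flat (zgen k l m) = 2 * udInd a k * (udInd a m - udInd a l) := by
  rw [show udRow a = flat (udMat a) from rfl, flat_dotProduct_zgen _ hkl hkm]
  simp only [udMat, if_neg hkl, if_neg (Ne.symm hkl), if_neg hkm, if_neg (Ne.symm hkm)]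
  ring

/-- clique weights of a `Z_mix` generator lie in `[−2, 2]`. -/
theorem abs_udRow_dotProduct_zgen_le (a : Finset (Fin n)) {k l m : Fin n} (hkl : k ≠ l) (hkm : k ≠ m) :
    -2 ≤ udRow a ⬝ᵥ flat (zgen k l m) ∧ udRow a ⬝ᵥ flat (zgen k l m) ≤ 2 := by
  rw [udRow_dotProduct_zgen a hkl hkm, udInd_apply, udInd_apply, udInd_apply]
  split_ifs <;> norm_num

/-! ### the direction `W^z` -/

/-- the pair index: `s(t) = s(t+k) = t+1` on `[2k]`, `0` on the idle index. -/
def sIdx (x : Fin n) : ℕ := if (x : ℕ) < 2 * kk n then (x : ℕ) % kk n + 1 else 0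

/-- `sIdx x = x + 1` on the first half. -/
theorem sIdx_of_lt {x : Fin n} (hx : (x : ℕ) < kk n) : sIdx x = x + 1 := by
  unfold sIdx; rw [if_pos (by omega), Nat.mod_eq_of_lt hx]

/-- `sIdx (ι₁ t) = t + 1`. -/
theorem sIdx_ι₁ (t : Fin (kk n)) : sIdx (ι₁ t : Fin n) = t + 1 := sIdx_of_lt (by simp)

/-- `sIdx (ι₂ t) = t + 1`. -/
theorem sIdx_ι₂ (t : Fin (kk n)) : sIdx (ι₂ t : Fin n) = t + 1 := by
  have := t.2
  simp only [sIdx, ι₂_val]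
  rw [if_pos (by omega), Nat.add_mod_right, Nat.mod_eq_of_lt this]

/-- `sIdx x ≤ ⌊n/2⌋`. -/
theorem sIdx_le (x : Fin n) : sIdx x ≤ kk n := by
  unfold sIdx
  split_ifs with h
  · have hk : 0 < kk n := by omega
    have := Nat.mod_lt (x : ℕ) hk
    omega
  · exact Nat.zero_le _

/-- the penalty `μ = 2n³` (at least the total positive mass of `W^z`). -/
def μz (n : ℕ) : ℤ := 2 * (n : ℤ) ^ 3

/-- the integer table of `W^z`: zero diagonal; `−μ` on partners and at the idle index; `2(s(x)+s(y))` across pairs. -/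
def WzInt (x y : Fin n) : ℤ :=
  if x = y then 0 else if (sIdx x = sIdx y ∨ sIdx x = 0 ∨ sIdx y = 0) then -μz n else 2 * ((sIdx x + sIdx y : ℕ) : ℤ)

/-- ★ the located direction `W^z`. -/
def Wz (n : ℕ) : Matrix (Fin n) (Fin n) ℝ := fun x y => (WzInt x y : ℝ)

/-- `W^z x y` is the integer `WzInt x y` cast to `ℝ`. -/
theorem Wz_apply (x y : Fin n) : Wz n x y = (WzInt x y : ℝ) := rfl

/-- `WzInt` is symmetric. -/
theorem WzInt_symm (x y : Fin n) : WzInt x y = WzInt y x := by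
  unfold WzInt
  by_cases h : x = y
  · subst h; rfl
  · rw [if_neg h, if_neg (Ne.symm h)]
    have hiff : (sIdx x = sIdx y ∨ sIdx x = 0 ∨ sIdx y = 0) ↔ (sIdx y = sIdx x ∨ sIdx y = 0 ∨ sIdx x = 0) := by
      constructor <;> rintro (h | h | h) <;> omega
    by_cases hc : sIdx x = sIdx y ∨ sIdx x = 0 ∨ sIdx y = 0
    · rw [if_pos hc, if_pos (hiff.mp hc)]
    · rw [if_neg hc, if_neg (fun h' => hc (hiff.mpr h'))]; push_cast; ring

/-- `W^z` is symmetric. -/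
theorem Wz_symm (x y : Fin n) : Wz n x y = Wz n y x := by rw [Wz_apply, Wz_apply, WzInt_symm]

/-- `WzInt x x = 0` (zero diagonal). -/
theorem WzInt_self (x : Fin n) : WzInt x x = 0 := by simp [WzInt]

/-- `WzInt x y ≤ 2n`. -/
theorem WzInt_le (x y : Fin n) : WzInt x y ≤ 2 * n := by
  unfold WzInt μz
  split_ifs
  · positivity
  · nlinarith [sq_nonneg (n : ℤ), (by positivity : (0 : ℤ) ≤ n)]
  · have h1 := sIdx_le x; have h2 := sIdx_le y
    have h3 : 2 * kk n ≤ n := by unfold kk; omega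
    push_cast; omega

/-- the pencil values of `W^z` are INTEGERS: a positive difference is `≥ 1`, a negative one `≤ −1`. -/
theorem Wz_sub_trichotomy (x y y' : Fin n) :
    Wz n x y - Wz n x y' ≤ -1 ∨ Wz n x y - Wz n x y' = 0 ∨ 1 ≤ Wz n x y - Wz n x y' := by
  rw [Wz_apply, Wz_apply, ← Int.cast_sub]
  rcases lt_trichotomy (WzInt x y - WzInt x y') 0 with h | h | h
  · left; exact_mod_cast (show WzInt x y - WzInt x y' ≤ -1 by omega)
  · right; left; exact_mod_cast h
  · right; right; exact_mod_cast (show (1 : ℤ) ≤ WzInt x y - WzInt x y' by omega)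

/-- three LEFT endpoints are never unpinned: `W^z_{kl} − W^z_{km} = 2(l − m) ≠ 0`. -/
theorem Wz_sub_ne_zero_of_lt {k l m : Fin n} (hk : (k : ℕ) < kk n) (hl : (l : ℕ) < kk n) (hm : (m : ℕ) < kk n)
    (hkl : k ≠ l) (hkm : k ≠ m) (hlm : l ≠ m) : Wz n k l - Wz n k m ≠ 0 := by
  have hkl' : (k : ℕ) ≠ l := fun h => hkl (Fin.ext h)
  have hkm' : (k : ℕ) ≠ m := fun h => hkm (Fin.ext h)
  have hlm' : (l : ℕ) ≠ m := fun h => hlm (Fin.ext h)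
  rw [Wz_apply, Wz_apply]
  unfold WzInt
  rw [if_neg hkl, if_neg hkm, sIdx_of_lt hk, sIdx_of_lt hl, sIdx_of_lt hm, if_neg (by omega), if_neg (by omega)]
  push_cast
  intro h
  apply hlm'
  have : (l : ℝ) = m := by linarith
  exact_mod_cast this

/-! ### the exact rhs: `h_COR(W^z) = F⋆`, attained exactly on the transversal face -/

/-- `Σ_{x,y ∈ b} W_{xy}` form of a located read. -/
theorem flat_dotProduct_udPt_sum (W : Matrix (Fin n) (Fin n) ℝ) (b : Finset (Fin n)) :
    flat W ⬝ᵥ udPt b = ∑ x ∈ b, ∑ y ∈ b, W x y := by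
  classical
  rw [flat_dotProduct_udPt]
  have inner : ∀ x, ∑ y, W x y * (udInd b x * udInd b y) = if x ∈ b then ∑ y ∈ b, W x y else 0 := by
    intro x
    by_cases hx : x ∈ b
    · rw [if_pos hx]
      have h : ∀ y, W x y * (udInd b x * udInd b y) = if y ∈ b then W x y else 0 := by
        intro y
        rw [udInd_apply, udInd_apply, if_pos hx]
        split_ifs <;> simp
      simp_rw [h]
      rw [← Finset.sum_filter, Finset.filter_mem_eq_inter, Finset.univ_inter]
    · rw [if_neg hx]
      exact Finset.sum_eq_zero fun y _ => by rw [udInd_apply b x, if_neg hx]; ring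
  simp_rw [inner]
  rw [← Finset.sum_filter, Finset.filter_mem_eq_inter, Finset.univ_inter]

/-- the representative of pair `u` on the transversal `B_S`. -/
def rep (S : Finset (Fin (kk n))) (u : Fin (kk n)) : Fin n := if u ∈ S then ι₁ u else ι₂ u

/-- `sIdx (rep S u) = u + 1`. -/
theorem sIdx_rep (S : Finset (Fin (kk n))) (u : Fin (kk n)) : sIdx (rep S u : Fin n) = u + 1 := by
  unfold rep; split_ifs
  exacts [sIdx_ι₁ u, sIdx_ι₂ u]

/-- `rep S` is injective. -/
theorem rep_injective (S : Finset (Fin (kk n))) : Function.Injective (rep (n := n) S) := by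
  intro u v h
  have := congrArg sIdx h
  rw [sIdx_rep, sIdx_rep] at this
  exact Fin.ext (by omega)

/-- `B_S` is the range of `rep S`. -/
theorem mem_Bcol_iff_rep (S : Finset (Fin (kk n))) (x : Fin n) : x ∈ Bcol S ↔ ∃ u, x = rep S u := by
  classical
  constructor
  · intro hx
    rcases Finset.mem_union.mp hx with h | h
    · obtain ⟨u, hu, rfl⟩ := Finset.mem_map.mp h
      exact ⟨u, by simp [rep, hu, ι₁e]⟩
    · obtain ⟨u, hu, rfl⟩ := Finset.mem_map.mp h
      rw [Finset.mem_compl] at hu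
      exact ⟨u, by simp [rep, hu, ι₂e]⟩
  · rintro ⟨u, rfl⟩
    unfold rep
    split_ifs with hu
    · exact (ι₁_mem_Bcol S u).mpr hu
    · exact (ι₂_mem_Bcol S u).mpr hu

/-- summing over `B_S` = summing over the representatives `rep S u`. -/
theorem sum_Bcol (g : Fin n → ℝ) (S : Finset (Fin (kk n))) : ∑ x ∈ Bcol S, g x = ∑ u, g (rep S u) := by
  classical
  have hdisj : Disjoint (S.map (ι₁e n)) (Sᶜ.map (ι₂e n)) := by
    refine Finset.disjoint_left.mpr fun x hx hx' => ?_
    obtain ⟨u, -, rfl⟩ := Finset.mem_map.mp hx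
    obtain ⟨v, -, hv⟩ := Finset.mem_map.mp hx'
    exact ι₁_ne_ι₂ u v hv.symm
  rw [Bcol, Finset.sum_union hdisj, Finset.sum_map, Finset.sum_map, ← Finset.sum_add_sum_compl S (fun u => g (rep S u))]
  congr 1
  · exact Finset.sum_congr rfl fun u hu => by simp [rep, hu, ι₁e]
  · exact Finset.sum_congr rfl fun u hu => by
      rw [Finset.mem_compl] at hu
      simp [rep, hu, ι₂e]

/-- the TRANSVERSAL VALUE `F⋆ = Σ_{u ≠ v} 2(u+1+v+1)` (the same for every transversal). -/
def Fstar (n : ℕ) : ℝ := ∑ u : Fin (kk n), ∑ v : Fin (kk n), (if u = v then (0 : ℝ) else 2 * (((u : ℕ) : ℝ) + 1 + (((v : ℕ) : ℝ) + 1)))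

/-- `W^z` on two representatives: `0` on the diagonal, `2(u+1+v+1)` off it. -/
theorem Wz_rep (S : Finset (Fin (kk n))) (u v : Fin (kk n)) :
    Wz n (rep S u) (rep S v) = if u = v then (0 : ℝ) else 2 * (((u : ℕ) : ℝ) + 1 + (((v : ℕ) : ℝ) + 1)) := by
  rw [Wz_apply]
  unfold WzInt
  by_cases h : u = v
  · subst h; simp
  · have hne : rep S u ≠ rep S v := fun h' => h (rep_injective S h')
    have huv : (u : ℕ) ≠ v := fun h' => h (Fin.ext h')
    rw [if_neg hne, if_neg h, sIdx_rep, sIdx_rep, if_neg (by omega)]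
    push_cast; ring

/-- `W^z` is nonnegative on representatives. -/
theorem Wz_rep_nonneg (S : Finset (Fin (kk n))) (u v : Fin (kk n)) : 0 ≤ Wz n (rep S u) (rep S v) := by
  rw [Wz_rep]; split_ifs <;> positivity

/-- every transversal reads `F⋆`. -/
theorem Wz_dotProduct_Bcol (S : Finset (Fin (kk n))) : flat (Wz n) ⬝ᵥ udPt (Bcol S) = Fstar n := by
  rw [flat_dotProduct_udPt_sum, sum_Bcol]
  unfold Fstar
  refine Finset.sum_congr rfl fun u _ => ?_
  rw [sum_Bcol]
  exact Finset.sum_congr rfl fun v _ => Wz_rep S u v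

/-- `0 ≤ F⋆`. -/
theorem Fstar_nonneg : 0 ≤ Fstar n :=
  Finset.sum_nonneg fun _ _ => Finset.sum_nonneg fun _ _ => by split_ifs <;> positivity

/-- ★ VALIDITY with the exact rhs: every vertex of `COR(n)` reads `≤ F⋆` against `W^z`. -/
theorem Wz_dotProduct_udPt_le (b : Finset (Fin n)) : flat (Wz n) ⬝ᵥ udPt b ≤ Fstar n := by
  classical
  rw [flat_dotProduct_udPt_sum]
  by_cases hbad : ∃ x ∈ b, ∃ y ∈ b, x ≠ y ∧ (sIdx x = sIdx y ∨ sIdx x = 0 ∨ sIdx y = 0)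
  · -- BAD CASE: a `−μ` entry is present and dominates all positive mass
    obtain ⟨x, hx, y, hy, hxy, hb⟩ := hbad
    have hWxy : Wz n x y = -(2 * (n : ℝ) ^ 3) := by
      rw [Wz_apply]; unfold WzInt μz; rw [if_neg hxy, if_pos hb]; push_cast; ring
    rw [← Finset.sum_product']
    have hmem : (x, y) ∈ b ×ˢ b := Finset.mk_mem_product hx hy
    rw [← Finset.add_sum_erase _ _ hmem]
    have hrest : ∑ p ∈ (b ×ˢ b).erase (x, y), Wz n p.1 p.2 ≤ ((b ×ˢ b).erase (x, y)).card • (2 * (n : ℝ)) :=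
      Finset.sum_le_card_nsmul _ _ _ fun p _ => by
        rw [Wz_apply]; exact_mod_cast WzInt_le p.1 p.2
    rw [nsmul_eq_mul] at hrest
    have hcard : ((((b ×ˢ b).erase (x, y)).card : ℕ) : ℝ) ≤ (n : ℝ) ^ 2 := by
      have h1 := Finset.card_erase_le (s := b ×ˢ b) (a := (x, y))
      have h2 : (b ×ˢ b).card = b.card * b.card := Finset.card_product _ _
      have h3 : b.card ≤ n := by simpa using Finset.card_le_univ b
      have : ((b ×ˢ b).erase (x, y)).card ≤ n ^ 2 := by
        rw [pow_two]; exact h1.trans (h2 ▸ Nat.mul_le_mul h3 h3)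
      exact_mod_cast this
    have hF := Fstar_nonneg (n := n)
    have hn : (0 : ℝ) ≤ 2 * n := by positivity
    nlinarith [mul_le_mul_of_nonneg_right hcard hn]
  · -- GOOD CASE: no partners, no idle index (unless `b` is a singleton)
    push Not at hbad
    by_cases hz : ∃ x ∈ b, sIdx x = 0
    · obtain ⟨x, hx, hx0⟩ := hz
      have hb : b = {x} := by
        refine Finset.eq_singleton_iff_unique_mem.mpr ⟨hx, fun y hy => ?_⟩
        by_contra hne
        exact (hbad y hy x hx hne).2.2 hx0
      rw [hb, Finset.sum_singleton, Finset.sum_singleton, Wz_apply, WzInt_self, Int.cast_zero]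
      exact Fstar_nonneg
    · push Not at hz
      -- `b` is a partial transversal: `b ⊆ B_S` with `S = {u : ι₂ u ∉ b}`
      let S : Finset (Fin (kk n)) := Finset.univ.filter (fun u => (ι₂ u : Fin n) ∉ b)
      have hsub : b ⊆ Bcol S := by
        intro x hx
        have hx2 : (x : ℕ) < 2 * kk n := by
          by_contra h
          exact hz x hx (by unfold sIdx; rw [if_neg h])
        by_cases hxk : (x : ℕ) < kk n
        · have hxe : x = ι₁ (⟨x, hxk⟩ : Fin (kk n)) := Fin.ext rfl
          rw [hxe, ι₁_mem_Bcol]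
          simp only [S, Finset.mem_filter, Finset.mem_univ, true_and]
          intro h2
          have hne : x ≠ ι₂ (⟨x, hxk⟩ : Fin (kk n)) := by
            intro h; have := congrArg Fin.val h; simp at this; omega
          apply (hbad x hx _ h2 hne).1
          rw [sIdx_of_lt hxk, sIdx_ι₂]
        · have hu : (x : ℕ) - kk n < kk n := by omega
          have hxe : x = ι₂ (⟨(x : ℕ) - kk n, hu⟩ : Fin (kk n)) := Fin.ext (by simp; omega)
          rw [hxe, ι₂_mem_Bcol]
          simp only [S, Finset.mem_filter, Finset.mem_univ, true_and, not_not]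
          rw [← hxe]; exact hx
      have hnonneg : ∀ x ∈ Bcol S, ∀ y ∈ Bcol S, 0 ≤ Wz n x y := by
        intro x hx y hy
        obtain ⟨u, rfl⟩ := (mem_Bcol_iff_rep S x).mp hx
        obtain ⟨v, rfl⟩ := (mem_Bcol_iff_rep S y).mp hy
        exact Wz_rep_nonneg S u v
      calc ∑ x ∈ b, ∑ y ∈ b, Wz n x y ≤ ∑ x ∈ b, ∑ y ∈ Bcol S, Wz n x y :=
            Finset.sum_le_sum fun x hx => Finset.sum_le_sum_of_subset_of_nonneg hsub fun y hy _ => hnonneg x (hsub hx) y hy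
        _ ≤ ∑ x ∈ Bcol S, ∑ y ∈ Bcol S, Wz n x y :=
            Finset.sum_le_sum_of_subset_of_nonneg hsub fun x hx _ => Finset.sum_nonneg fun y hy => hnonneg x hx y hy
        _ = Fstar n := by rw [← flat_dotProduct_udPt_sum]; exact Wz_dotProduct_Bcol S

/-- ★ the EXACT RHS of the located direction `W^z`. -/
theorem hCOR_Wz : hCOR (Wz n) = Fstar n :=
  le_antisymm (Finset.sup'_le _ _ fun b _ => Wz_dotProduct_udPt_le b)
    (by have h := le_hCOR (Wz n) (Bcol ∅); rwa [Wz_dotProduct_Bcol] at h)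

end ZgenCube

end Summit.ValiantsHypothesis.ValiantsHypothesis.Theorems.FifoMatching.ExactPencil
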